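import Summits.HodgeConjecture.HodgeConjecture.Theorems.K2E5QuatZetaAbsConvOfThetaTail   -- ★ (γ) p855831: brings ★ #3g `quatZeta`, ★ #3j∕#3j-bis (`quatAdelicUnitsOne`, `quatRatLatticeOne`, `quatModuleSection`), ★ `quotientMeasure`, Mathlib improper integrals
import Literature.NumberTheory.Automorphic.AdelicPoissonSummation                      -- ★ `piFundamentalDomain` (the Poisson covolume factor of the socket)
import HarnessLib

/-!
# K2 ∕ E5 «TamagawaUnitary» — tier-2 file `K2E5QuatZetaResidueOfParts`: the RESIDUE SKELETON of socket G3 `sig_K2E5QuatZetaResidue`, CLOSED MODULO THREE NAMED PARTS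

Track B «K2-LIT», engine E5, crux H413 (`stmt-HodgeConjecture-24833`); seat K2E5-p07 (g0), G3 RESIDUE LEAD (K2E5-plan (g2) SWEEP #12b (26), 2026-09-04).  Layer (R0) of the
layered plan R0–R5 for `Theorems/K2E5QuatZetaResidue.lean` (Tate–Weil road of the socket docstring: disintegrate `dx = dx¹ ⊗ dt` along the central ray `θ_{e^t}`,
unfold over `Γ_h`, Poisson on the contracting half `t ≤ 0`).  With the INNER INTEGRAL `I(t) := ∫_{D^{(1)}_{h,𝔸}} Φ(y θ_{e^t}) dx¹(y)` the three parts are: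
* (R1, `hZ` + `hIm`) the SPLIT `Z(Φ, s; dx) = ∫_ℝ e^{st} I(t) dt` for real `s > 1` (disintegration hypothesis of the socket + `|det(yθ_t)|_𝔸 = e^t` + Fubini, licensed by ★ (g)
  `K2E5QuatZetaAbsConv`), and measurability of `I`;
* (R2, `hplus`) the EXPANDING HALF: `‖I(t)‖ ≤ B e^{−2t}` for `t > 0` (unfolding with Weil constant one + ★ `K2E5QuatThetaBounds.thetaTail_le_exp` at rate 2 + Fujisaki ★ G1′);
* (R4 ⊇ R3, `hminus`) the CONTRACTING HALF = POISSON PRINCIPAL PART: `‖e^{t}(I(t) + V Φ(0)) − V·(∫Φ∘quatCoord dν⁴)∕ν⁴(F)‖ ≤ B e^{κ t}` for `t ≤ 0`, some `κ > 0`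
  (Poisson ★ `AdeleRing.pi_tsum_eq_inv_measure_mul_tsum_piFourierCoeff` over `D_h = Γ_h ∪ {0}` transported by ★ `quatCoordEquiv`, ★ p14 `integral_quatCoord_mul_left`, dual theta tail).
THIS FILE (pure real analysis, no sorry): `tendsto_sub_one_mul_of_parts` — from (R1)(R2)(R4) in abstract form, `(s − 1) Z(s) → A` as `s → 1⁺`, by splitting `∫_ℝ = ∫_{t>0} + ∫_{t≤0}`,
`∫_{t≤0} e^{(s−1)t} dt = 1∕(s−1)`, `∫_{t≤0} e^{st} dt = 1∕s`, and two uniform bounds; and `quatZetaResidue_of_parts` — the socket's conclusion BYTES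
`Tendsto (fun s : ℝ => ((s : ℂ) − 1) * quatZeta L Ha dx Φ s) (𝓝[>] 1) (𝓝 (V · (∫ Φ∘quatCoord dν⁴) ∕ ν⁴(piFundamentalDomain)))` from the three named parts stated on the
CONCRETE inner integral.  Layers R1 (`K2E5QuatZetaSplit`), R2 (`K2E5QuatZetaPlusBound`), R3 (`K2E5QuatThetaPoisson`), R4 (`K2E5QuatZetaMinusPrincipalPart`) pay `hZ`∕`hIm`,
`hplus`, `hminus` by name; R5 `K2E5QuatZetaResidue` = this file fed with them.  No `instance`, no `notation`, axioms ⊆ the trio.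

HONEST LABEL: HC_CM is proved only modulo the 7 printed citations (2 remaining named inputs: hLiu418 = stmt-HodgeConjecture-24832, h413 = stmt-HodgeConjecture-24833) until rung 0
closes; this file is a helper (`--supports stmt-HodgeConjecture-24833 --as helper`) and changes no count.

## References
[VignerasLNM800] M.-F. Vignéras, LNM 800 (1980), Ch. III §2 Thm. 2.2 · [WeilBNT1967] A. Weil, *Basic Number Theory* (1967), Ch. VII §5 Prop. 11, §6 · [TateThesis1967] J. Tate,
in Cassels–Fröhlich (1967), Ch. XV §4.4 (Main Theorem 4.4.1).
-/

set_option autoImplicit false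
set_option linter.dupNamespace false

noncomputable section

namespace Summit.HodgeConjecture.HodgeConjecture.Cruxes.H413.K2E5QuatZetaResidueOfParts

open NumberField IsDedekindDomain MeasureTheory MeasureTheory.Measure Filter Topology Set
open scoped Matrix MatrixGroups NNReal ENNReal
open Literature.MeasureTheory.Group Literature.NumberTheory Literature.NumberTheory.Automorphic
open Summit.HodgeConjecture.HodgeConjecture.Cruxes.H413.K2E5QuatAdelicMatrixModel
open Summit.HodgeConjecture.HodgeConjecture.Cruxes.H413.K2E5QuatZeta
open Summit.HodgeConjecture.HodgeConjecture.Cruxes.H413.K2E5QuatAdelicLattice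
open Summit.HodgeConjecture.HodgeConjecture.Cruxes.H413.K2E5QuatAdelicModuleOne

/-! ## §1 Two half-line estimates and two explicit integrals -/

/-- `t ↦ e^{a t} · I(t)` is a.e.-strongly measurable when `I` is. [folklore] -/
theorem aestronglyMeasurable_exp_mul {I : ℝ → ℂ} (hIm : AEStronglyMeasurable I volume) (a : ℝ) :
    AEStronglyMeasurable (fun t : ℝ => (Real.exp (a * t) : ℂ) * I t) volume :=
  (Complex.continuous_ofReal.comp (Real.continuous_exp.comp (continuous_const.mul continuous_id))).aestronglyMeasurable.mul hIm

/-- Exponential domination on `t > 0` at a rate `a < 0` gives integrability on `Ioi 0` and the bound `‖∫_{t>0} f‖ ≤ B · (−1∕a)`. [folklore] -/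
theorem integrableOn_Ioi_of_norm_le_exp {f : ℝ → ℂ} (hf : AEStronglyMeasurable f volume) {B a : ℝ} (ha : a < 0)
    (h : ∀ t : ℝ, 0 < t → ‖f t‖ ≤ B * Real.exp (a * t)) :
    IntegrableOn f (Ioi 0) ∧ ‖∫ t in Ioi 0, f t‖ ≤ B * (-1 / a) := by
  have hg : IntegrableOn (fun t : ℝ => B * Real.exp (a * t)) (Ioi 0) := (integrableOn_exp_mul_Ioi ha 0).const_mul B
  have hbound : ∀ᵐ t ∂(volume.restrict (Ioi (0 : ℝ))), ‖f t‖ ≤ B * Real.exp (a * t) := ae_restrict_of_forall_mem measurableSet_Ioi h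
  have hfi : IntegrableOn f (Ioi 0) := Integrable.mono' hg hf.restrict hbound
  refine ⟨hfi, (norm_integral_le_of_norm_le hg hbound).trans_eq ?_⟩
  rw [integral_const_mul, integral_exp_mul_Ioi ha, mul_zero, Real.exp_zero]

/-- Exponential domination on `t ≤ 0` at a rate `a > 0` gives integrability on `Iic 0` and the bound `‖∫_{t≤0} f‖ ≤ B · (1∕a)`. [folklore] -/
theorem integrableOn_Iic_of_norm_le_exp {f : ℝ → ℂ} (hf : AEStronglyMeasurable f volume) {B a : ℝ} (ha : 0 < a)
    (h : ∀ t : ℝ, t ≤ 0 → ‖f t‖ ≤ B * Real.exp (a * t)) :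
    IntegrableOn f (Iic 0) ∧ ‖∫ t in Iic 0, f t‖ ≤ B * (1 / a) := by
  have hg : IntegrableOn (fun t : ℝ => B * Real.exp (a * t)) (Iic 0) := (integrableOn_exp_mul_Iic ha 0).const_mul B
  have hbound : ∀ᵐ t ∂(volume.restrict (Iic (0 : ℝ))), ‖f t‖ ≤ B * Real.exp (a * t) := ae_restrict_of_forall_mem measurableSet_Iic h
  have hfi : IntegrableOn f (Iic 0) := Integrable.mono' hg hf.restrict hbound
  refine ⟨hfi, (norm_integral_le_of_norm_le hg hbound).trans_eq ?_⟩
  rw [integral_const_mul, integral_exp_mul_Iic ha, mul_zero, Real.exp_zero]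

/-- `∫_{t ≤ 0} e^{a t} · C dt = a⁻¹ · C` in `ℂ` for `a > 0`, with integrability. [folklore] -/
theorem integral_Iic_exp_mul_const {a : ℝ} (ha : 0 < a) (C : ℂ) :
    IntegrableOn (fun t : ℝ => (Real.exp (a * t) : ℂ) * C) (Iic 0) ∧ ∫ t in Iic 0, (Real.exp (a * t) : ℂ) * C = ((a⁻¹ : ℝ) : ℂ) * C := by
  have hi : IntegrableOn (fun t : ℝ => (Real.exp (a * t) : ℂ)) (Iic 0) := (integrableOn_exp_mul_Iic ha 0).ofReal
  refine ⟨hi.mul_const C, ?_⟩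
  rw [integral_mul_const, integral_complex_ofReal, integral_exp_mul_Iic ha, mul_zero, Real.exp_zero, one_div, Complex.ofReal_inv]

/-! ## §2 The abstract residue lemma: `(s − 1) Z(s) → A` from the three parts -/

/-- **`(s − 1) · Z(s) → A` as `s → 1⁺`** when, for real `s > 1`, `Z(s) = ∫_ℝ e^{st} I(t) dt` with `I` measurable, `‖I(t)‖ ≤ B e^{−2t}` on `t > 0`, and on `t ≤ 0` the
principal part `‖e^{t}(I(t) + c) − A‖ ≤ B' e^{κ t}` (`κ > 0`): then `Z(s) = [bounded] + A∕(s−1) − c∕s + [bounded]` near `s = 1⁺`.  Tate's bookkeeping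
`∫_{t≤0} e^{(s−1)t} dt = 1∕(s−1)`, `∫_{t≤0} e^{st} dt = 1∕s`, abstracted from the zeta integral. [cite: TateThesis1967, §4.4] [cite: WeilBNT1967, Ch. VII §5 Prop. 11] -/
theorem tendsto_sub_one_mul_of_parts {Z I : ℝ → ℂ} {A c : ℂ}
    (hIm : AEStronglyMeasurable I volume)
    (hZ : ∀ s : ℝ, 1 < s → Z s = ∫ t : ℝ, (Real.exp (s * t) : ℂ) * I t)
    (hplus : ∃ B : ℝ, ∀ t : ℝ, 0 < t → ‖I t‖ ≤ B * Real.exp (-2 * t))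
    (hminus : ∃ B κ : ℝ, 0 < κ ∧ ∀ t : ℝ, t ≤ 0 → ‖(Real.exp t : ℂ) * (I t + c) - A‖ ≤ B * Real.exp (κ * t)) :
    Tendsto (fun s : ℝ => ((s : ℂ) - 1) * Z s) (𝓝[>] (1 : ℝ)) (𝓝 A) := by
  obtain ⟨Bp, hp⟩ := hplus
  obtain ⟨Bm, κ, hκ, hm⟩ := hminus
  -- the error term of the contracting half
  set E : ℝ → ℂ := fun t => (Real.exp t : ℂ) * (I t + c) - A with hE
  have hEm : AEStronglyMeasurable E volume :=
    ((Complex.continuous_ofReal.comp Real.continuous_exp).aestronglyMeasurable.mul (hIm.add aestronglyMeasurable_const)).sub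
      aestronglyMeasurable_const
  -- the constants are non-negative
  have hBp : 0 ≤ Bp := by
    have h := (norm_nonneg _).trans (hp 1 one_pos)
    exact le_of_mul_le_mul_right (by rwa [zero_mul]) (Real.exp_pos (-2 * 1))
  have hBm : 0 ≤ Bm := by
    have h := (norm_nonneg _).trans (hm 0 le_rfl)
    rwa [mul_zero, Real.exp_zero, mul_one] at h
  -- the key uniform bound on `(1, 3/2]`
  have hkey : ∀ s : ℝ, 1 < s → s ≤ 3 / 2 → ‖((s : ℂ) - 1) * Z s - A‖ ≤ (s - 1) * (Bp * 2 + Bm * (1 / κ) + ‖c‖) := by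
    intro s hs hs'
    -- (i) the expanding half `t > 0`
    have hI1 : ∀ t : ℝ, 0 < t → ‖(Real.exp (s * t) : ℂ) * I t‖ ≤ Bp * Real.exp (-(1 / 2) * t) := by
      intro t ht
      rw [norm_mul, Complex.norm_real, Real.norm_of_nonneg (Real.exp_nonneg _)]
      calc Real.exp (s * t) * ‖I t‖ ≤ Real.exp (s * t) * (Bp * Real.exp (-2 * t)) := mul_le_mul_of_nonneg_left (hp t ht) (Real.exp_nonneg _)
        _ = Bp * Real.exp ((s - 2) * t) := by rw [mul_left_comm, ← Real.exp_add]; ring_nf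
        _ ≤ Bp * Real.exp (-(1 / 2) * t) := mul_le_mul_of_nonneg_left (Real.exp_le_exp.2 (by nlinarith)) hBp
    obtain ⟨hP, hPn⟩ := integrableOn_Ioi_of_norm_le_exp (aestronglyMeasurable_exp_mul hIm s) (by norm_num : (-(1 / 2) : ℝ) < 0) hI1
    have hPn' : ‖∫ t in Ioi 0, (Real.exp (s * t) : ℂ) * I t‖ ≤ Bp * 2 := by
      refine hPn.trans_eq ?_
      norm_num
    -- (ii) the contracting half `t ≤ 0`: error term, polar term, constant term
    have hE1 : ∀ t : ℝ, t ≤ 0 → ‖(Real.exp ((s - 1) * t) : ℂ) * E t‖ ≤ Bm * Real.exp (κ * t) := by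
      intro t ht
      rw [norm_mul, Complex.norm_real, Real.norm_of_nonneg (Real.exp_nonneg _)]
      calc Real.exp ((s - 1) * t) * ‖E t‖ ≤ 1 * (Bm * Real.exp (κ * t)) :=
            mul_le_mul (Real.exp_le_one_iff.2 (by nlinarith)) (hm t ht) (norm_nonneg _) zero_le_one
        _ = Bm * Real.exp (κ * t) := one_mul _
    obtain ⟨hQ, hQn⟩ := integrableOn_Iic_of_norm_le_exp (aestronglyMeasurable_exp_mul hEm (s - 1)) hκ hE1
    obtain ⟨hR, hRv⟩ := integral_Iic_exp_mul_const (sub_pos.2 hs) A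
    obtain ⟨hS, hSv⟩ := integral_Iic_exp_mul_const (zero_lt_one.trans hs) c
    -- the pointwise decomposition `e^{st} I(t) = e^{(s-1)t} E(t) + e^{(s-1)t} A − e^{st} c`
    have hdec : ∀ t : ℝ, (Real.exp (s * t) : ℂ) * I t =
        (Real.exp ((s - 1) * t) : ℂ) * E t + (Real.exp ((s - 1) * t) : ℂ) * A - (Real.exp (s * t) : ℂ) * c := by
      intro t
      have h1 : (Real.exp (s * t) : ℂ) = (Real.exp ((s - 1) * t) : ℂ) * (Real.exp t : ℂ) := by
        rw [← Complex.ofReal_mul, ← Real.exp_add]; ring_nf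
      rw [hE, h1]; ring
    have hdec' : (fun t : ℝ => (Real.exp (s * t) : ℂ) * I t) =
        fun t => (Real.exp ((s - 1) * t) : ℂ) * E t + (Real.exp ((s - 1) * t) : ℂ) * A - (Real.exp (s * t) : ℂ) * c := funext hdec
    have hM : IntegrableOn (fun t : ℝ => (Real.exp (s * t) : ℂ) * I t) (Iic 0) := by
      rw [hdec']; exact (hQ.add hR).sub hS
    have hQR : IntegrableOn (fun t : ℝ => (Real.exp ((s - 1) * t) : ℂ) * E t + (Real.exp ((s - 1) * t) : ℂ) * A) (Iic 0) := hQ.add hR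
    have hMv : ∫ t in Iic 0, (Real.exp (s * t) : ℂ) * I t =
        (∫ t in Iic 0, (Real.exp ((s - 1) * t) : ℂ) * E t) + (((s - 1)⁻¹ : ℝ) : ℂ) * A - ((s⁻¹ : ℝ) : ℂ) * c := by
      rw [hdec', integral_sub hQR hS, integral_add hQ hR, hRv, hSv]
    -- total: `Z s = P + (Q + A/(s-1) − c/s)`
    have hZs : Z s = (∫ t in Ioi 0, (Real.exp (s * t) : ℂ) * I t) +
        ((∫ t in Iic 0, (Real.exp ((s - 1) * t) : ℂ) * E t) + (((s - 1)⁻¹ : ℝ) : ℂ) * A - ((s⁻¹ : ℝ) : ℂ) * c) := by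
      rw [hZ s hs, ← intervalIntegral.integral_Iic_add_Ioi hM hP, hMv, add_comm]
    have h1 : ((s : ℂ) - 1) * ((((s - 1)⁻¹ : ℝ) : ℂ) * A) = A := by
      rw [← mul_assoc, Complex.ofReal_inv, Complex.ofReal_sub, Complex.ofReal_one,
        mul_inv_cancel₀ (sub_ne_zero.2 (by exact_mod_cast hs.ne')), one_mul]
    have hdiff : ((s : ℂ) - 1) * Z s - A = ((s : ℂ) - 1) * (∫ t in Ioi 0, (Real.exp (s * t) : ℂ) * I t) +
        ((s : ℂ) - 1) * (∫ t in Iic 0, (Real.exp ((s - 1) * t) : ℂ) * E t) - ((s : ℂ) - 1) * (((s⁻¹ : ℝ) : ℂ) * c) := by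
      rw [hZs, mul_add, mul_sub, mul_add, h1]; ring
    -- norms
    have hs1 : ‖(s : ℂ) - 1‖ = s - 1 := by
      rw [← Complex.ofReal_one, ← Complex.ofReal_sub, Complex.norm_real, Real.norm_of_nonneg (sub_nonneg.2 hs.le)]
    have hsc : ‖((s⁻¹ : ℝ) : ℂ) * c‖ ≤ ‖c‖ := by
      rw [norm_mul, Complex.norm_real, Real.norm_of_nonneg (inv_nonneg.2 (zero_le_one.trans hs.le))]
      exact mul_le_of_le_one_left (norm_nonneg _) (inv_le_one_of_one_le₀ hs.le)
    rw [hdiff]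
    calc ‖((s : ℂ) - 1) * (∫ t in Ioi 0, (Real.exp (s * t) : ℂ) * I t) +
            ((s : ℂ) - 1) * (∫ t in Iic 0, (Real.exp ((s - 1) * t) : ℂ) * E t) - ((s : ℂ) - 1) * (((s⁻¹ : ℝ) : ℂ) * c)‖
        ≤ ‖((s : ℂ) - 1) * (∫ t in Ioi 0, (Real.exp (s * t) : ℂ) * I t)‖ +
            ‖((s : ℂ) - 1) * (∫ t in Iic 0, (Real.exp ((s - 1) * t) : ℂ) * E t)‖ + ‖((s : ℂ) - 1) * (((s⁻¹ : ℝ) : ℂ) * c)‖ :=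
          (norm_sub_le _ _).trans (add_le_add (norm_add_le _ _) le_rfl)
      _ = (s - 1) * ‖∫ t in Ioi 0, (Real.exp (s * t) : ℂ) * I t‖ + (s - 1) * ‖∫ t in Iic 0, (Real.exp ((s - 1) * t) : ℂ) * E t‖ +
            (s - 1) * ‖((s⁻¹ : ℝ) : ℂ) * c‖ := by simp only [norm_mul, hs1]
      _ ≤ (s - 1) * (Bp * 2) + (s - 1) * (Bm * (1 / κ)) + (s - 1) * ‖c‖ := by
          have hs0 : 0 ≤ s - 1 := sub_nonneg.2 hs.le
          exact add_le_add (add_le_add (mul_le_mul_of_nonneg_left hPn' hs0) (mul_le_mul_of_nonneg_left hQn hs0)) (mul_le_mul_of_nonneg_left hsc hs0)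
      _ = (s - 1) * (Bp * 2 + Bm * (1 / κ) + ‖c‖) := by ring
  -- conclusion: squeeze
  rw [← tendsto_sub_nhds_zero_iff]
  refine squeeze_zero_norm' (a := fun s : ℝ => (s - 1) * (Bp * 2 + Bm * (1 / κ) + ‖c‖)) ?_ ?_
  · filter_upwards [Ioo_mem_nhdsGT (show (1 : ℝ) < 3 / 2 by norm_num)] with s hs
    exact hkey s hs.1 hs.2.le
  · have h : Tendsto (fun s : ℝ => (s - 1) * (Bp * 2 + Bm * (1 / κ) + ‖c‖)) (𝓝 (1 : ℝ)) (𝓝 ((1 - 1) * (Bp * 2 + Bm * (1 / κ) + ‖c‖))) :=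
      ((continuous_id.sub continuous_const).mul continuous_const).tendsto 1
    rw [sub_self, zero_mul] at h
    exact h.mono_left nhdsWithin_le_nhds

/-! ## §3 The socket's conclusion from the three parts on the concrete inner integral -/

section Concrete

set_option synthInstance.maxHeartbeats 400000
set_option maxHeartbeats 1600000

variable (L : Type) [Field L] [NumberField L] [IsCMField L] (Ha : Matrix (Fin 2) (Fin 2) L)
  (hHa : (Ha.map (cmConjRingHom L)).transpose = Ha) (hdet : Ha.det ≠ 0)
  [MeasurableSpace (GL (Fin 2) (AdeleRing (𝓞 L) L))] [BorelSpace (GL (Fin 2) (AdeleRing (𝓞 L) L))]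
  [MeasurableSpace (AdeleRing (𝓞 ↥(maximalRealSubfield L)) ↥(maximalRealSubfield L))]
  [MeasurableSpace (↥(quatAdelicUnitsOne L Ha) ⧸ quatRatLatticeOne L Ha)] [BorelSpace (↥(quatAdelicUnitsOne L Ha) ⧸ quatRatLatticeOne L Ha)]
  [LocallyCompactSpace ↥(quatAdelicUnitsOne L Ha)] [SecondCountableTopology ↥(quatAdelicUnitsOne L Ha)] [T2Space ↥(quatAdelicUnitsOne L Ha)]

/-- **THE RESIDUE OF `Z(Φ, s)` AT `s = 1` FROM THE THREE PARTS** (socket G3's conclusion, token for token): with the inner integral `I(t) := ∫ Φ(y θ_{e^t}) dx¹(y)`, the split (R1)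
`Z(Φ,s) = ∫ e^{st} I(t) dt` (`s > 1`), the expanding-half bound (R2) and the Poisson principal part of the contracting half (R4) give
`(s − 1) Z(Φ, s) → covol(D^{(1)}_{h,𝔸} ∕ Γ_h, dx¹) · (∫ Φ∘quatCoord dν⁴) ∕ ν⁴(𝔸⁺⁴ ∕ L⁺⁴)` as `s → 1⁺`.
[cite: VignerasLNM800, Ch. III §2 Thm. 2.2] [cite: WeilBNT1967, Ch. VII §5 Prop. 11] [cite: TateThesis1967, §4.4] -/
theorem quatZetaResidue_of_parts
    (ν : Measure (AdeleRing (𝓞 ↥(maximalRealSubfield L)) ↥(maximalRealSubfield L)))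
    (dx : Measure ↥(quatAdelicUnits L Ha))
    (dx1 : Measure ↥(quatAdelicUnitsOne L Ha)) [dx1.IsHaarMeasure] [dx1.IsMulRightInvariant]
    [(count : Measure ↥(quatRatLatticeOne L Ha)).IsHaarMeasure]
    (Φ : Matrix (Fin 2) (Fin 2) (AdeleRing (𝓞 L) L) → ℂ)
    -- (R1) measurability of the inner integral and the split of the zeta integral along the central ray
    (hIm : AEStronglyMeasurable (fun t : ℝ => ∫ y : ↥(quatAdelicUnitsOne L Ha), Φ ((((y : ↥(quatAdelicUnits L Ha)) *
        quatModuleSection L Ha (Units.mk0 (Real.toNNReal (Real.exp t)) (Real.toNNReal_pos.2 (Real.exp_pos t)).ne') : ↥(quatAdelicUnits L Ha)) :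
          GL (Fin 2) (AdeleRing (𝓞 L) L)) : Matrix (Fin 2) (Fin 2) (AdeleRing (𝓞 L) L)) ∂dx1) volume)
    (hZ : ∀ s : ℝ, 1 < s → quatZeta L Ha dx Φ (s : ℂ) = ∫ t : ℝ, (Real.exp (s * t) : ℂ) *
      ∫ y : ↥(quatAdelicUnitsOne L Ha), Φ ((((y : ↥(quatAdelicUnits L Ha)) *
        quatModuleSection L Ha (Units.mk0 (Real.toNNReal (Real.exp t)) (Real.toNNReal_pos.2 (Real.exp_pos t)).ne') : ↥(quatAdelicUnits L Ha)) :
          GL (Fin 2) (AdeleRing (𝓞 L) L)) : Matrix (Fin 2) (Fin 2) (AdeleRing (𝓞 L) L)) ∂dx1)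
    -- (R2) the expanding half
    (hplus : ∃ B : ℝ, ∀ t : ℝ, 0 < t → ‖∫ y : ↥(quatAdelicUnitsOne L Ha), Φ ((((y : ↥(quatAdelicUnits L Ha)) *
        quatModuleSection L Ha (Units.mk0 (Real.toNNReal (Real.exp t)) (Real.toNNReal_pos.2 (Real.exp_pos t)).ne') : ↥(quatAdelicUnits L Ha)) :
          GL (Fin 2) (AdeleRing (𝓞 L) L)) : Matrix (Fin 2) (Fin 2) (AdeleRing (𝓞 L) L)) ∂dx1‖ ≤ B * Real.exp (-2 * t))
    -- (R4) the Poisson principal part of the contracting half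
    (hminus : ∃ B κ : ℝ, 0 < κ ∧ ∀ t : ℝ, t ≤ 0 → ‖(Real.exp t : ℂ) *
        ((∫ y : ↥(quatAdelicUnitsOne L Ha), Φ ((((y : ↥(quatAdelicUnits L Ha)) *
            quatModuleSection L Ha (Units.mk0 (Real.toNNReal (Real.exp t)) (Real.toNNReal_pos.2 (Real.exp_pos t)).ne') : ↥(quatAdelicUnits L Ha)) :
              GL (Fin 2) (AdeleRing (𝓞 L) L)) : Matrix (Fin 2) (Fin 2) (AdeleRing (𝓞 L) L)) ∂dx1) +
          (((quotientMeasure (quatRatLatticeOne L Ha) (count : Measure ↥(quatRatLatticeOne L Ha)) (isClosed_quatRatLatticeOne L Ha) dx1)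
              Set.univ).toReal : ℂ) * Φ 0) -
        (((quotientMeasure (quatRatLatticeOne L Ha) (count : Measure ↥(quatRatLatticeOne L Ha)) (isClosed_quatRatLatticeOne L Ha) dx1)
              Set.univ).toReal : ℂ) *
            (∫ a, Φ (quatCoord L (fun i => ((quatBasis L Ha hHa hdet i : ↥(quatRatSubalgebra L Ha)) : Matrix (Fin 2) (Fin 2) L)) a)
                ∂(Measure.pi fun _ : Fin 4 => ν)) /
            (((Measure.pi fun _ : Fin 4 => ν) (piFundamentalDomain (↥(maximalRealSubfield L)) (Fin 4))).toReal : ℂ)‖ ≤ B * Real.exp (κ * t)) :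
    Tendsto (fun s : ℝ => ((s : ℂ) - 1) * quatZeta L Ha dx Φ (s : ℂ)) (𝓝[>] (1 : ℝ))
      (𝓝 ((((quotientMeasure (quatRatLatticeOne L Ha) (count : Measure ↥(quatRatLatticeOne L Ha)) (isClosed_quatRatLatticeOne L Ha) dx1)
              Set.univ).toReal : ℂ) *
            (∫ a, Φ (quatCoord L (fun i => ((quatBasis L Ha hHa hdet i : ↥(quatRatSubalgebra L Ha)) : Matrix (Fin 2) (Fin 2) L)) a)
                ∂(Measure.pi fun _ : Fin 4 => ν)) /
            (((Measure.pi fun _ : Fin 4 => ν) (piFundamentalDomain (↥(maximalRealSubfield L)) (Fin 4))).toReal : ℂ))) :=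
  tendsto_sub_one_mul_of_parts hIm hZ hplus hminus

end Concrete

end Summit.HodgeConjecture.HodgeConjecture.Cruxes.H413.K2E5QuatZetaResidueOfParts

end
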